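import Summits.NavierStokesRegularity.NavierStokesRegularity.Theorems.ExtremiserTransienceRegularisedNearPlateauStabilityBangBangCoreCutoff
import Literature.Analysis.FluidPDE.TaoEnstrophyLocalisation
import Literature.Analysis.FluidPDE.EnstrophyGronwall
import Mathlib.Analysis.Calculus.ContDiff.Bounds
import HarnessLib

/-!
# Route `ExtremiserTransience`, crux `RegularisedNearPlateauStability` (stmt-NavierStokesRegularity-28317),
# LINE g8-α «sparse bang-bang»: LOCAL TOOLS FOR THE TOP TEST FIELD `η = −ζ·ψ̂`

`--supports stmt-NavierStokesRegularity-28317` (helper). Author: prover seat `ns-net-p2` (g2).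

Pointwise and integral bookkeeping used by the construction of the test field of step P4 (`TopTestField`) of
`Cruxes/NearExtremalTransiencePerFlow/Lines/sparse_bangbang.lean`:
* `curl_smul_eq`, `norm_curlCLM_smulRight_le` — `curl(ζψ) = ζ·curl ψ + curl∘(Dζ ⊗ ψ)` and the size of the gauge term;
* `norm_shrink_le` — the SHRINKING INEQUALITY at a point: `‖v + σ·(−(ζv + R))‖ ≤ (1−σ)M` for `|σ| ≤ δ/(2(2+Λ'))` when
  `‖R‖ ≤ Λ'M` and either `‖v‖ ≤ (1−δ/2)M` or (`ζ = 1`, `R = 0`);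
* `norm_iteratedFDeriv_smul_le_pow` — Leibniz in budget form `‖Dⁿ(ζψ)‖ ≤ 2ⁿ·P·Q·Lⁿ`;
* `norm_iteratedFDeriv_levelCutoff_le_three` — one constant `C_ζ(S,τ)` with `‖Dⁱζ‖ ≤ C_ζ·Lⁱ` for `i ≤ 3`;
* `integral_le_of_le_on` and `curl_bounds_of_support` — `‖D(curl η)‖`, `Z(curl η)`, `W(curl η)` from sup bounds on
  `D²η, D³η` and the volume of a closed set off which `η` vanishes.
HONEST FRAMING: calculus bookkeeping; nothing about Navier–Stokes is proved; no summit is proved by a line. [folklore]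
-/

noncomputable section

open MeasureTheory Set Metric Filter Topology
open scoped InnerProductSpace RealInnerProductSpace ENNReal ContDiff
open Literature.Analysis.FluidPDE
open Summit.NavierStokesRegularity.NavierStokesRegularity.Theorems.DepletionLadder.KStar.HalfSpace

namespace Summit.NavierStokesRegularity.NavierStokesRegularity.Theorems

-- the problem directory repeats the summit name (`NavierStokesRegularity/NavierStokesRegularity`)
set_option linter.dupNamespace false

namespace DepletionLadder.KStar.BangBang

/-! ## 1. The curl of a scalar multiple and the shrinking inequality -/

/-- `curl(ζψ)(x) = ζ(x)·curl ψ(x) + curl∘(Dζ(x) ⊗ ψ(x))`. [folklore] -/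
theorem curl_smul_eq {ζ : E3 → ℝ} {ψ : E3 → E3} {x : E3} (hζ : DifferentiableAt ℝ ζ x) (hψ : DifferentiableAt ℝ ψ x) :
    curl (fun y => ζ y • ψ y) x = ζ x • curl ψ x + curlCLM ((fderiv ℝ ζ x).smulRight (ψ x)) := by
  rw [curl_eq_curlCLM, curl_eq_curlCLM, fderiv_fun_smul hζ hψ, map_add, map_smul]

/-- Size of the gauge term: `‖curl∘(L ⊗ e)‖ ≤ ‖curlCLM‖·‖L‖·‖e‖`. [folklore] -/
theorem norm_curlCLM_smulRight_le (L : E3 →L[ℝ] ℝ) (e : E3) : ‖curlCLM (L.smulRight e)‖ ≤ ‖curlCLM‖ * ‖L‖ * ‖e‖ := by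
  calc ‖curlCLM (L.smulRight e)‖ ≤ ‖curlCLM‖ * ‖L.smulRight e‖ := curlCLM.le_opNorm _
    _ = ‖curlCLM‖ * ‖L‖ * ‖e‖ := by rw [ContinuousLinearMap.norm_smulRight_apply, mul_assoc]

/-- **The shrinking inequality at a point.** For vectors `v, R` with `‖v‖ ≤ M`, a weight `z ∈ [0,1]`, a gauge term
`‖R‖ ≤ Λ'·M` (`Λ' ≥ 0`), and `|σ| ≤ δ/(2(2+Λ'))` (`0 < δ ≤ 2`): if either `‖v‖ ≤ (1−δ/2)M` or `z = 1 ∧ R = 0`, then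
`‖v + σ·(−(z·v + R))‖ ≤ (1−σ)·M`. [folklore] -/
theorem norm_shrink_le {vx R : E3} {M z σ δ Λ' : ℝ} (hM : ‖vx‖ ≤ M) (hz0 : 0 ≤ z) (hz1 : z ≤ 1) (hδ : 0 < δ)
    (hδ2 : δ ≤ 2) (hΛ' : 0 ≤ Λ') (hR : ‖R‖ ≤ Λ' * M) (hσ : |σ| ≤ δ / (2 * (2 + Λ')))
    (hcase : ‖vx‖ ≤ (1 - δ / 2) * M ∨ (z = 1 ∧ R = 0)) :
    ‖vx + σ • (-(z • vx + R))‖ ≤ (1 - σ) * M := by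
  have hM0 : 0 ≤ M := (norm_nonneg _).trans hM
  have hσabs : σ ≤ |σ| := le_abs_self σ
  have hσ₀le : δ / (2 * (2 + Λ')) ≤ 1 / 2 := by
    rw [div_le_iff₀ (by positivity)]; nlinarith
  have hσ1 : |σ| ≤ 1 / 2 := hσ.trans hσ₀le
  rcases hcase with hlow | ⟨hz, hR0⟩
  · -- transition region: `(1 - σ z) v - σ R`
    have hrw : vx + σ • (-(z • vx + R)) = (1 - σ * z) • vx - σ • R := by
      rw [smul_neg, smul_add, smul_smul, sub_smul, one_smul]; abel
    rw [hrw]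
    have h1 : |1 - σ * z| ≤ 1 + |σ| := by
      have : |σ * z| ≤ |σ| := by
        rw [abs_mul, abs_of_nonneg hz0]; exact mul_le_of_le_one_right (abs_nonneg _) hz1
      calc |1 - σ * z| ≤ |(1 : ℝ)| + |σ * z| := abs_sub _ _
        _ ≤ 1 + |σ| := by rw [abs_one]; linarith
    have hkey : |σ| * (2 + Λ') ≤ δ / 2 := by
      have h := (le_div_iff₀ (by positivity : (0 : ℝ) < 2 * (2 + Λ'))).1 hσ
      linarith
    have hcoef : (1 + |σ|) * (1 - δ / 2) + |σ| * Λ' ≤ 1 - |σ| := by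
      nlinarith [hkey, abs_nonneg σ, mul_nonneg (abs_nonneg σ) hδ.le]
    have hlow0 : 0 ≤ (1 - δ / 2) * M := mul_nonneg (by linarith) hM0
    calc ‖(1 - σ * z) • vx - σ • R‖ ≤ ‖(1 - σ * z) • vx‖ + ‖σ • R‖ := norm_sub_le _ _
      _ = |1 - σ * z| * ‖vx‖ + |σ| * ‖R‖ := by rw [norm_smul, norm_smul, Real.norm_eq_abs, Real.norm_eq_abs]
      _ ≤ (1 + |σ|) * ((1 - δ / 2) * M) + |σ| * (Λ' * M) :=
          add_le_add (mul_le_mul h1 hlow (norm_nonneg _) (by positivity)) (mul_le_mul_of_nonneg_left hR (abs_nonneg _))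
      _ = ((1 + |σ|) * (1 - δ / 2) + |σ| * Λ') * M := by ring
      _ ≤ (1 - |σ|) * M := mul_le_mul_of_nonneg_right hcoef hM0
      _ ≤ (1 - σ) * M := mul_le_mul_of_nonneg_right (by linarith) hM0
  · -- plateau: `(1 - σ) v`
    subst hz; subst hR0
    have hrw : vx + σ • (-((1 : ℝ) • vx + 0)) = (1 - σ) • vx := by
      rw [one_smul, add_zero, smul_neg, sub_smul, one_smul]; abel
    rw [hrw, norm_smul, Real.norm_eq_abs, abs_of_nonneg (by linarith [abs_nonneg σ])]
    exact mul_le_mul_of_nonneg_left hM (by linarith [abs_nonneg σ])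

/-! ## 2. Leibniz in budget form; one constant for the level cut-off up to order three -/

/-- **Leibniz in budget form**: `‖Dⁱζ(x)‖ ≤ P·Lⁱ`, `‖Dⁱψ(x)‖ ≤ Q·Lⁱ` (`i ≤ n`) ⇒ `‖Dⁿ(ζψ)(x)‖ ≤ 2ⁿ·P·Q·Lⁿ`. [folklore] -/
theorem norm_iteratedFDeriv_smul_le_pow {ζ : E3 → ℝ} {ψ : E3 → E3} (hζ : ContDiff ℝ ∞ ζ) (hψ : ContDiff ℝ ∞ ψ) (x : E3)
    {n : ℕ} {P Q L : ℝ} (hζb : ∀ i, i ≤ n → ‖iteratedFDeriv ℝ i ζ x‖ ≤ P * L ^ i)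
    (hψb : ∀ i, i ≤ n → ‖iteratedFDeriv ℝ i ψ x‖ ≤ Q * L ^ i) :
    ‖iteratedFDeriv ℝ n (fun y => ζ y • ψ y) x‖ ≤ 2 ^ n * (P * Q * L ^ n) := by
  have h := norm_iteratedFDeriv_smul_le (N := ∞) hζ hψ x (n := n) (by exact_mod_cast le_top)
  refine h.trans ?_
  have hs := sum_choose_mul_le (n := n) (a := 0) (b := 0) (u := fun i => ‖iteratedFDeriv ℝ i ζ x‖)
    (w := fun i => ‖iteratedFDeriv ℝ i ψ x‖) (P := P) (Q := Q) (L := L) (fun _ => norm_nonneg _) (fun _ => norm_nonneg _)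
    (fun i hi => by rw [add_zero]; exact hζb i hi) (fun i hi => by rw [add_zero]; exact hψb i hi)
  simpa using hs

/-- **One derivative constant for the level cut-off up to order three.** If `‖Dʲv(x)‖ ≤ S·M·Lʲ` for `j ≤ 3`
(`M, τ > 0`, `L ≥ 0`), then for every `i ≤ 3`: `‖Dⁱζ(x)‖ ≤ C_ζ·Lⁱ` with `C_ζ = 48·36·256³·(2·max(1,S²/τ))³`. [folklore] -/
theorem norm_iteratedFDeriv_levelCutoff_le_three {v : E3 → E3} (hv : ContDiff ℝ ∞ v) {S M L a τ : ℝ} (hτ : 0 < τ)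
    (hM : 0 < M) (hL : 0 ≤ L) {x : E3} (hK : ∀ j, j ≤ 3 → ‖iteratedFDeriv ℝ j v x‖ ≤ S * M * L ^ j) {i : ℕ} (hi : i ≤ 3) :
    ‖iteratedFDeriv ℝ i (fun y => Real.smoothTransition ((‖v y‖ ^ 2 / M ^ 2 - a) / τ)) x‖ ≤
      (48 * 36 * 256 ^ 3 * (2 * max 1 (S ^ 2 / τ)) ^ 3) * L ^ i := by
  have h := norm_iteratedFDeriv_levelCutoff_le (a := a) hv hτ hM hL (n := i) (fun j hj => hK j (hj.trans hi))
  refine h.trans ?_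
  rw [mul_pow, ← mul_assoc]
  refine mul_le_mul_of_nonneg_right ?_ (pow_nonneg hL _)
  have hm : (1 : ℝ) ≤ 2 * max 1 (S ^ 2 / τ) := by linarith [le_max_left (1 : ℝ) (S ^ 2 / τ)]
  have hfac : (i.factorial : ℝ) ≤ 6 := by
    have : i.factorial ≤ (3 : ℕ).factorial := Nat.factorial_le hi
    exact_mod_cast this
  have hfac0 : (0 : ℝ) ≤ i.factorial := Nat.cast_nonneg _
  have h256 : (256 : ℝ) ^ i ≤ 256 ^ 3 := pow_le_pow_right₀ (by norm_num) hi
  have hmax : (2 * max 1 (S ^ 2 / τ)) ^ i ≤ (2 * max 1 (S ^ 2 / τ)) ^ 3 := pow_le_pow_right₀ hm hi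
  have hm0 : (0 : ℝ) ≤ (2 * max 1 (S ^ 2 / τ)) ^ i := pow_nonneg (by linarith) _
  have hA : (i.factorial : ℝ) * (8 * (i.factorial : ℝ) ^ 2 * 256 ^ i) ≤ 6 * (8 * 6 ^ 2 * 256 ^ 3) := by
    have h62 : (i.factorial : ℝ) ^ 2 ≤ 6 ^ 2 := pow_le_pow_left₀ hfac0 hfac 2
    have : 8 * (i.factorial : ℝ) ^ 2 * 256 ^ i ≤ 8 * 6 ^ 2 * 256 ^ 3 :=
      mul_le_mul (mul_le_mul_of_nonneg_left h62 (by norm_num)) h256 (by positivity) (by positivity)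
    exact mul_le_mul hfac this (by positivity) (by norm_num)
  calc (i.factorial : ℝ) * (8 * (i.factorial : ℝ) ^ 2 * 256 ^ i) * (2 * max 1 (S ^ 2 / τ)) ^ i
      ≤ 6 * (8 * 6 ^ 2 * 256 ^ 3) * (2 * max 1 (S ^ 2 / τ)) ^ 3 := mul_le_mul hA hmax hm0 (by positivity)
    _ = 48 * 36 * 256 ^ 3 * (2 * max 1 (S ^ 2 / τ)) ^ 3 := by ring

/-! ## 3. Integral bounds from sup bounds and support -/

/-- `∫ f ≤ C·vol(K)` when `‖f‖ ≤ C` on `K` (finite volume) and `f = 0` off `K`. [folklore] -/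
theorem integral_le_of_le_on {f : E3 → ℝ} {K : Set E3} {C : ℝ} (hK : volume K < ⊤)
    (hle : ∀ x ∈ K, ‖f x‖ ≤ C) (hzero : ∀ x, x ∉ K → f x = 0) : ∫ x, f x ≤ C * (volume K).toReal := by
  rw [← setIntegral_eq_integral_of_forall_compl_eq_zero hzero]
  exact (le_abs_self _).trans ((Real.norm_eq_abs _).symm.le.trans (norm_setIntegral_le_of_norm_le_const hK hle))

/-- **`D(curl η)`, `Z(curl η)`, `W(curl η)` from sup bounds on `D²η`, `D³η` and the support.** If `η ∈ C^∞` vanishes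
on the complement of a closed set `K` of finite volume and `‖D²η‖ ≤ C₂`, `‖D³η‖ ≤ C₃` everywhere, then
`‖D(curl η)(x)‖ ≤ ‖curlCLM‖·C₂`, `Z(curl η) ≤ (‖curlCLM‖²C₂)²·vol K`, `W(curl η) ≤ 3(‖curlCLM‖²C₃)²·vol K`. [folklore] -/
theorem curl_bounds_of_support {η : E3 → E3} (hη : ContDiff ℝ ∞ η) {K : Set E3} (hKc : IsClosed K)
    (hKvol : volume K < ⊤) (hzero : ∀ x, x ∉ K → η x = 0) {C₂ C₃ : ℝ}
    (h2 : ∀ x, ‖iteratedFDeriv ℝ 2 η x‖ ≤ C₂) (h3 : ∀ x, ‖iteratedFDeriv ℝ 3 η x‖ ≤ C₃) :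
    (∀ x, ‖fderiv ℝ (curl η) x‖ ≤ ‖curlCLM‖ * C₂) ∧
      Zen (curl η) ≤ (‖curlCLM‖ ^ 2 * C₂) ^ 2 * (volume K).toReal ∧
      Wpa (curl η) ≤ 3 * (‖curlCLM‖ ^ 2 * C₃) ^ 2 * (volume K).toReal := by
  have hc0 : 0 ≤ ‖curlCLM‖ := norm_nonneg curlCLM
  have hcη : ContDiff ℝ ∞ (curl η) := contDiff_curl_top hη
  -- off `K` all iterated derivatives of `η` vanish
  have hvan : ∀ x, x ∉ K → ∀ n, iteratedFDeriv ℝ n η x = 0 := by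
    intro x hx n
    have hev : η =ᶠ[𝓝 x] fun _ => (0 : E3) := by
      filter_upwards [hKc.isOpen_compl.mem_nhds hx] with y hy
      exact hzero y hy
    rw [(hev.iteratedFDeriv ℝ n).eq_of_nhds, iteratedFDeriv_fun_zero]
    rfl
  have hD1 : ∀ (g : E3 → E3) (x : E3), ‖fderiv ℝ g x‖ = ‖iteratedFDeriv ℝ 1 g x‖ := fun g x => by
    rw [← norm_iteratedFDeriv_fderiv, norm_iteratedFDeriv_zero]
  refine ⟨fun x => ?_, ?_, ?_⟩
  · rw [hD1]
    exact (norm_D_curl_le hη 1 x).trans (mul_le_mul_of_nonneg_left (h2 x) hc0)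
  · -- `Z(curl η) = ∫ ‖curl curl η‖²`
    have hpt : ∀ x, ‖curl (curl η) x‖ ≤ ‖curlCLM‖ ^ 2 * ‖iteratedFDeriv ℝ 2 η x‖ := fun x => norm_curl_curl_le_D2 hη x
    refine integral_le_of_le_on hKvol (fun x _ => ?_) (fun x hx => ?_)
    · rw [Real.norm_of_nonneg (sq_nonneg _)]
      have h := (hpt x).trans (mul_le_mul_of_nonneg_left (h2 x) (by positivity))
      exact pow_le_pow_left₀ (norm_nonneg _) h 2
    · have h := hpt x
      rw [hvan x hx 2, norm_zero, mul_zero] at h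
      have : curl (curl η) x = 0 := norm_le_zero_iff.1 h
      rw [this, norm_zero]; ring
  · -- `W(curl η) = ∫ |D curl curl η|²_F ≤ ∫ 3 ‖D curl curl η‖²`
    have hcc : ContDiff ℝ ∞ (curl (curl η)) := contDiff_curl_top hcη
    have hpt : ∀ x, ‖fderiv ℝ (curl (curl η)) x‖ ≤ ‖curlCLM‖ ^ 2 * ‖iteratedFDeriv ℝ 3 η x‖ := by
      intro x
      rw [hD1]
      calc ‖iteratedFDeriv ℝ 1 (curl (curl η)) x‖ ≤ ‖curlCLM‖ * ‖iteratedFDeriv ℝ 2 (curl η) x‖ := norm_D_curl_le hcη 1 x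
        _ ≤ ‖curlCLM‖ * (‖curlCLM‖ * ‖iteratedFDeriv ℝ 3 η x‖) :=
            mul_le_mul_of_nonneg_left (norm_D_curl_le hη 2 x) hc0
        _ = ‖curlCLM‖ ^ 2 * ‖iteratedFDeriv ℝ 3 η x‖ := by ring
    refine integral_le_of_le_on hKvol (fun x _ => ?_) (fun x hx => ?_)
    · rw [Real.norm_of_nonneg (frobeniusNormSq_nonneg _)]
      have h := (hpt x).trans (mul_le_mul_of_nonneg_left (h3 x) (by positivity))
      calc frobeniusNormSq (fderiv ℝ (curl (curl η)) x) ≤ 3 * ‖fderiv ℝ (curl (curl η)) x‖ ^ 2 :=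
            frobeniusNormSq_le_three_mul _
        _ ≤ 3 * (‖curlCLM‖ ^ 2 * C₃) ^ 2 := by gcongr
    · have h := hpt x
      rw [hvan x hx 3, norm_zero, mul_zero] at h
      have : fderiv ℝ (curl (curl η)) x = 0 := norm_le_zero_iff.1 h
      rw [this, frobeniusNormSq_zero]

end DepletionLadder.KStar.BangBang

end Summit.NavierStokesRegularity.NavierStokesRegularity.Theorems

end
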